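import Literature.NumberTheory.Automorphic.TruncatedKernelCompact

/-!
# `T_k Λ` is compact for every continuous compactly supported kernel
(Iwaniec, *Spectral Methods of Automorphic Forms*, GSM 53, §4.2–4.3 (Props. 4.3–4.5) and §6.4
(6.29): the truncated invariant integral operator is of Hilbert–Schmidt type, hence compact;
PDF pp. 49–51, 88)

A brick of the Eisenstein-free proof of the pretrace estimate (12.5)
(`Literature.NumberTheory.Automorphic.Iwaniec2002_eq_12_5`), whose kernels `k` are merely
continuous. `TruncatedKernelCompact.isCompactOperator_kernelCLM_comp_truncOp` gives the compactness
of `T_k Λ` (`Λ = 1 - Σ_i V_i V_i†` the truncation of the constant terms above `Y`) for Lipschitz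
`k`; here it is extended to continuous `k` by a norm limit:

1. (§1) kernels are subtracted termwise: `T_{k - k'} = T_k - T_{k'}` (`kernelCLM_sub_kernel`), and
   the Schur bound `‖T_k‖ ≤ C_k/2`, `C_k = 8π ∫_0^∞ |k|`, makes `k ↦ T_k` continuous for the sup norm
   on `[0, M]` (`schurConst_le_of_abs_le`);
2. (§2) the moving averages `k_η(u) = η⁻¹ ∫_u^{u+η} k` are Lipschitz test kernels vanishing on
   `[M, ∞)` and converge to `k` uniformly on `[0, ∞)` as `η → 0` (`avgKernel`, uniform continuity);
3. (§3) **`T_k Λ` is compact** (`isCompactOperator_kernelCLM_comp_truncOp_of_continuous`): the norm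
   limit of the compact operators `T_{k_η} Λ` (`isCompactOperator_of_tendsto`).

Everything here is proved; nothing is vendored; no fact is introduced.

## References
* [Iwaniec2002] H. Iwaniec, *Spectral Methods of Automorphic Forms*, 2nd ed., GSM 53, AMS 2002,
  §1.8 (Schur bound), Props. 4.3–4.5 & §6.4 (6.29), PDF pp. 20–21, 49–51, 88
  (held copy `book:iwaniec2002-spectral-methods-automorphic-forms`).
-/

noncomputable section

open MeasureTheory Set Filter Real UpperHalfPlane
open scoped Topology MatrixGroups ComplexConjugate NNReal ENNReal Pointwise

namespace Literature.NumberTheory.Automorphic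

variable {Γ : Subgroup (GL (Fin 2) ℝ)} {F : Set ℍ} {k k' : ℝ → ℝ}

/-! ## 1. Subtracting kernels and the Schur bound -/

section Linear

/-- The difference of two test kernels is a test kernel. [folklore] -/
theorem IsTestKernel.sub (hk : IsTestKernel k) (hk' : IsTestKernel k') : IsTestKernel fun u => k u - k' u := by
  obtain ⟨hm, ⟨B, hB⟩, ⟨M, hM0, hM⟩⟩ := hk
  obtain ⟨hm', ⟨B', hB'⟩, ⟨M', _, hM'⟩⟩ := hk'
  refine ⟨hm.sub hm', ⟨B + B', fun u => ?_⟩, ⟨max M M', le_max_of_le_left hM0, fun u hu => ?_⟩⟩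
  · exact (abs_sub _ _).trans (add_le_add (hB u) (hB' u))
  · rw [hM u ((le_max_left _ _).trans hu), hM' u ((le_max_right _ _).trans hu), sub_zero]

variable (hΓ : Γ ≤ (Matrix.SpecialLinearGroup.toGL : SL(2, ℝ) →* GL (Fin 2) ℝ).range)
  (hneg : (-1 : GL (Fin 2) ℝ) ∈ Γ) (hd : IsDiscreteSubgroup Γ) (hF : IsHypFundamentalDomain Γ F)

include hΓ hd in
/-- The automorphic kernel is additive in the kernel: `K_{k - k'} = K_k - K_{k'}`. [folklore] -/
theorem automorphicKernel_sub_kernel {M M' : ℝ} (hM : ∀ u, M ≤ u → k u = 0) (hM' : ∀ u, M' ≤ u → k' u = 0)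
    (z w : ℍ) :
    automorphicKernel Γ (fun u => k u - k' u) z w = automorphicKernel Γ k z w - automorphicKernel Γ k' z w := by
  have hS := finite_hypBall hΓ hd z w (max M M')
  have hsub : ∀ u, max M M' ≤ u → (fun u => k u - k' u) u = 0 := fun u hu => by
    simp only
    rw [hM u ((le_max_left _ _).trans hu), hM' u ((le_max_right _ _).trans hu), sub_zero]
  rw [automorphicKernel_eq_sum hsub z w hS (fun γ hγ => hγ.1) (fun γ hγ hlt => ⟨hγ, hlt.le⟩),
    automorphicKernel_eq_sum hM z w hS (fun γ hγ => hγ.1) (fun γ hγ hlt => ⟨hγ, hlt.le.trans (le_max_left _ _)⟩),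
    automorphicKernel_eq_sum hM' z w hS (fun γ hγ => hγ.1) (fun γ hγ hlt => ⟨hγ, hlt.le.trans (le_max_right _ _)⟩),
    ← Finset.sum_sub_distrib]

include hΓ hneg hd hF in
/-- The kernel operators are additive in the kernel (pointwise). [folklore] -/
theorem kernelOp_sub_kernel (hk : IsTestKernel k) (hkc : Continuous k) (hk' : IsTestKernel k') (hkc' : Continuous k')
    {g : ℍ → ℂ} (hg : MemLp g 2 (volume.restrict F)) (z : ℍ) :
    kernelOp Γ F (fun u => k u - k' u) g z = kernelOp Γ F k g z - kernelOp Γ F k' g z := by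
  obtain ⟨_, _, ⟨M, _, hM⟩⟩ := id hk
  obtain ⟨_, _, ⟨M', _, hM'⟩⟩ := id hk'
  rw [kernelOp_apply, kernelOp_apply, kernelOp_apply, ← mul_sub,
    ← integral_sub (integrable_automorphicKernel_mul hΓ hneg hd hF hk hkc hg z)
      (integrable_automorphicKernel_mul hΓ hneg hd hF hk' hkc' hg z)]
  congr 1
  refine setIntegral_congr_fun hF.measurableSet fun w _ => ?_
  rw [automorphicKernel_sub_kernel hΓ hd hM hM' z w]
  push_cast
  ring

include hΓ hneg hd hF in
/-- **`T_{k - k'} = T_k - T_{k'}`** on `L²(F)`. [folklore] -/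
theorem kernelCLM_sub_kernel (hk : IsTestKernel k) (hkc : Continuous k) (hk' : IsTestKernel k') (hkc' : Continuous k') :
    kernelCLM hΓ hneg hd hF (hk.sub hk') (hkc.sub hkc') =
      kernelCLM hΓ hneg hd hF hk hkc - kernelCLM hΓ hneg hd hF hk' hkc' := by
  refine ContinuousLinearMap.ext fun g => Lp.ext ?_
  filter_upwards [kernelCLM_coeFn hΓ hneg hd hF (hk.sub hk') (hkc.sub hkc') g,
    Lp.coeFn_sub (kernelCLM hΓ hneg hd hF hk hkc g) (kernelCLM hΓ hneg hd hF hk' hkc' g),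
    kernelCLM_coeFn hΓ hneg hd hF hk hkc g, kernelCLM_coeFn hΓ hneg hd hF hk' hkc' g] with z h1 h2 h3 h4
  rw [h1, sub_apply, h2, Pi.sub_apply, h3, h4]
  exact kernelOp_sub_kernel hΓ hneg hd hF hk hkc hk' hkc' (Lp.memLp g) z

/-- **Schur bound for a uniformly small kernel**: if `|k| ≤ ε` on `(0, ∞)` and `k = 0` on `[M, ∞)`
(`0 ≤ M`) then `C_k ≤ 8π ε M`. [cite: Iwaniec2002, §1.8, PDF pp. 20–21] -/
theorem schurConst_le_of_abs_le (hkm : Measurable k) {ε M : ℝ} (hM0 : 0 ≤ M)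
    (hb : ∀ u, 0 < u → |k u| ≤ ε) (hM : ∀ u, M ≤ u → k u = 0) : schurConst k ≤ 8 * π * (ε * M) := by
  unfold schurConst
  gcongr
  have h1 : ∫ u in Ioi 0, |k u| = ∫ u in Ioc 0 M, |k u| := by
    refine setIntegral_eq_of_subset_of_forall_sdiff_eq_zero measurableSet_Ioi Ioc_subset_Ioi_self fun u hu => ?_
    have hu' : M < u := by
      by_contra h
      exact hu.2 ⟨hu.1, not_lt.mp h⟩
    rw [hM u hu'.le, abs_zero]
  rw [h1]
  have hint : IntegrableOn (fun u => |k u|) (Ioc 0 M) :=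
    Measure.integrableOn_of_bounded (s := Ioc 0 M) (μ := (volume : Measure ℝ)) (M := ε)
      (measure_Ioc_lt_top (a := (0 : ℝ)) (b := M)).ne hkm.abs.aestronglyMeasurable
      ((ae_restrict_iff' measurableSet_Ioc).mpr (Eventually.of_forall fun u hu => by
        rw [Real.norm_eq_abs, abs_abs]; exact hb u hu.1))
  calc ∫ u in Ioc 0 M, |k u| ≤ ∫ u in Ioc 0 M, ε :=
        setIntegral_mono_on hint (integrableOn_const (measure_Ioc_lt_top.ne)) measurableSet_Ioc fun u hu => hb u hu.1
    _ = ε * M := by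
        rw [setIntegral_const, Measure.real, Real.volume_Ioc, ENNReal.toReal_ofReal (by linarith), smul_eq_mul]
        ring

end Linear

/-! ## 2. The moving averages `k_η(u) = η⁻¹ ∫_u^{u+η} k` -/

section Average

/-- The moving average `k_η(u) = η⁻¹ ∫_u^{u+η} k(s) ds`. [folklore] -/
def avgKernel (k : ℝ → ℝ) (η : ℝ) (u : ℝ) : ℝ := η⁻¹ * ∫ s in u..(u + η), k s

variable {B M η : ℝ}

/-- `k_η = 0` on `[M, ∞)` when `k = 0` there (`η > 0`). [folklore] -/
theorem avgKernel_eq_zero (hM : ∀ u, M ≤ u → k u = 0) (hη : 0 < η) {u : ℝ} (hu : M ≤ u) :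
    avgKernel k η u = 0 := by
  unfold avgKernel
  rw [intervalIntegral.integral_congr (g := fun _ => (0 : ℝ)) (fun s hs => ?_), intervalIntegral.integral_zero, mul_zero]
  rw [uIcc_of_le (by linarith)] at hs
  exact hM s (hu.trans hs.1)

/-- `|k_η| ≤ B` when `|k| ≤ B` (`η > 0`). [folklore] -/
theorem abs_avgKernel_le (hB : ∀ u, |k u| ≤ B) (hη : 0 < η) (u : ℝ) : |avgKernel k η u| ≤ B := by
  unfold avgKernel
  have h1 : ‖∫ s in u..(u + η), k s‖ ≤ B * |u + η - u| :=
    intervalIntegral.norm_integral_le_of_norm_le_const fun s _ => by rw [Real.norm_eq_abs]; exact hB s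
  rw [add_sub_cancel_left, abs_of_pos hη, Real.norm_eq_abs] at h1
  rw [abs_mul, abs_inv, abs_of_pos hη]
  calc η⁻¹ * |∫ s in u..(u + η), k s| ≤ η⁻¹ * (B * η) := by gcongr
    _ = B := by field_simp

/-- `k_η` is Lipschitz with constant `2B/η` for continuous `k` with `|k| ≤ B`. [folklore] -/
theorem lipschitzWith_avgKernel (hkc : Continuous k) (hB : ∀ u, |k u| ≤ B) (hη : 0 < η) :
    LipschitzWith (Real.toNNReal (2 * B / η)) (avgKernel k η) := by
  have hB0 : 0 ≤ B := (abs_nonneg _).trans (hB 0)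
  have hii : ∀ a b : ℝ, IntervalIntegrable k volume a b := fun a b => hkc.intervalIntegrable a b
  refine LipschitzWith.of_dist_le_mul fun u v => ?_
  rw [Real.dist_eq, Real.dist_eq, Real.coe_toNNReal _ (by positivity)]
  unfold avgKernel
  -- `∫_u^{u+η} - ∫_v^{v+η} = ∫_u^v - ∫_{u+η}^{v+η}`
  have e : (∫ s in u..(u + η), k s) - ∫ s in v..(v + η), k s =
      (∫ s in u..v, k s) - ∫ s in (u + η)..(v + η), k s := by
    have h1 := intervalIntegral.integral_add_adjacent_intervals (hii u v) (hii v (v + η))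
    have h2 := intervalIntegral.integral_add_adjacent_intervals (hii u (u + η)) (hii (u + η) (v + η))
    linarith
  rw [← mul_sub, e, abs_mul, abs_inv, abs_of_pos hη]
  have h3 : |∫ s in u..v, k s| ≤ B * |u - v| := by
    have := intervalIntegral.norm_integral_le_of_norm_le_const (a := u) (b := v) (C := B) (f := k)
      fun s _ => by rw [Real.norm_eq_abs]; exact hB s
    rw [Real.norm_eq_abs, abs_sub_comm v u] at this
    exact this
  have h4 : |∫ s in (u + η)..(v + η), k s| ≤ B * |u - v| := by
    have := intervalIntegral.norm_integral_le_of_norm_le_const (a := u + η) (b := v + η) (C := B) (f := k)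
      fun s _ => by rw [Real.norm_eq_abs]; exact hB s
    rw [Real.norm_eq_abs, show v + η - (u + η) = v - u by ring, abs_sub_comm v u] at this
    exact this
  calc η⁻¹ * |(∫ s in u..v, k s) - ∫ s in (u + η)..(v + η), k s|
      ≤ η⁻¹ * (B * |u - v| + B * |u - v|) := by
        gcongr
        exact (abs_sub _ _).trans (add_le_add h3 h4)
    _ = 2 * B / η * |u - v| := by
        field_simp
        ring

/-- `k_η` is a Lipschitz test kernel vanishing on `[M, ∞)`. [folklore] -/
theorem isTestKernel_avgKernel (hkc : Continuous k) (hB : ∀ u, |k u| ≤ B) (hM : ∀ u, M ≤ u → k u = 0)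
    (hM0 : 0 ≤ M) (hη : 0 < η) : IsTestKernel (avgKernel k η) :=
  ⟨(lipschitzWith_avgKernel hkc hB hη).continuous.measurable, ⟨B, abs_avgKernel_le hB hη⟩,
    ⟨M, hM0, fun _ hu => avgKernel_eq_zero hM hη hu⟩⟩

/-- **Uniform approximation on `[0, ∞)`**: for continuous `k` vanishing on `[M, ∞)` and `ε > 0` there
is `η ∈ (0, 1]` with `|k_η(u) - k(u)| ≤ ε` for all `u ≥ 0` (uniform continuity of `k` on
`[0, M + 2]`). [folklore] -/
theorem exists_avgKernel_near (hkc : Continuous k) (hM : ∀ u, M ≤ u → k u = 0) {ε : ℝ}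
    (hε : 0 < ε) : ∃ η : ℝ, 0 < η ∧ η ≤ 1 ∧ ∀ u, 0 ≤ u → |avgKernel k η u - k u| ≤ ε := by
  have huc : UniformContinuousOn k (Icc 0 (M + 2)) :=
    isCompact_Icc.uniformContinuousOn_of_continuous hkc.continuousOn
  rw [Metric.uniformContinuousOn_iff] at huc
  obtain ⟨δ, hδ, hδε⟩ := huc ε hε
  refine ⟨min (δ / 2) 1, by positivity, min_le_right _ _, fun u hu => ?_⟩
  set η : ℝ := min (δ / 2) 1 with hηdef
  have hη : 0 < η := by positivity
  have hη1 : η ≤ 1 := min_le_right _ _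
  have hηδ : η < δ := lt_of_le_of_lt (min_le_left _ _) (by linarith)
  by_cases huM : M ≤ u
  · rw [avgKernel_eq_zero hM hη huM, hM u huM, sub_zero, abs_zero]
    exact hε.le
  · push Not at huM
    -- `k_η(u) - k(u) = η⁻¹ ∫_u^{u+η} (k s - k u) ds`
    have hii : IntervalIntegrable k volume u (u + η) := hkc.intervalIntegrable _ _
    have e : avgKernel k η u - k u = η⁻¹ * ∫ s in u..(u + η), (k s - k u) := by
      unfold avgKernel
      rw [intervalIntegral.integral_sub hii intervalIntegrable_const, intervalIntegral.integral_const,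
        add_sub_cancel_left, smul_eq_mul, mul_sub]
      field_simp
    rw [e, abs_mul, abs_inv, abs_of_pos hη]
    have h1 : ‖∫ s in u..(u + η), (k s - k u)‖ ≤ ε * |u + η - u| := by
      refine intervalIntegral.norm_integral_le_of_norm_le_const fun s hs => ?_
      rw [uIoc_of_le (by linarith)] at hs
      have hsI : s ∈ Icc 0 (M + 2) := ⟨by linarith [hs.1], by linarith [hs.2]⟩
      have huI : u ∈ Icc 0 (M + 2) := ⟨hu, by linarith⟩
      have hdist : dist s u < δ := by
        rw [Real.dist_eq, abs_of_nonneg (by linarith [hs.1])]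
        linarith [hs.2]
      have := hδε s hsI u huI hdist
      rw [Real.dist_eq] at this
      rw [Real.norm_eq_abs]
      exact this.le
    rw [add_sub_cancel_left, abs_of_pos hη, Real.norm_eq_abs] at h1
    calc η⁻¹ * |∫ s in u..(u + η), (k s - k u)| ≤ η⁻¹ * (ε * η) := by gcongr
      _ = ε := by field_simp

end Average

/-! ## 3. Compactness of `T_k Λ` for continuous `k` -/

namespace Fuchsian

variable {h : ℕ} {𝔞 : Fin h → OnePoint ℝ} {σ : Fin h → SL(2, ℝ)}

section Compact

variable (hΓ : Γ ≤ (Matrix.SpecialLinearGroup.toGL : SL(2, ℝ) →* GL (Fin 2) ℝ).range)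
  (hneg : (-1 : GL (Fin 2) ℝ) ∈ Γ) (hd : IsDiscreteSubgroup Γ) (hF : IsHypFundamentalDomain Γ F)
  (hvol : volume F < ⊤)
  (hinfty : ∀ i, (Matrix.SpecialLinearGroup.toGL (σ i) : GL (Fin 2) ℝ) • (OnePoint.infty : OnePoint ℝ) = 𝔞 i)
  (hper : ∀ i, (ConjAct.toConjAct (Matrix.SpecialLinearGroup.toGL (σ i) : GL (Fin 2) ℝ)⁻¹ • Γ).strictPeriods =
    AddSubgroup.zmultiples 1)
  (hineq : ∀ i j, ∀ γ ∈ Γ, γ • 𝔞 i = 𝔞 j → i = j)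
  (hcomplete : ∀ c : OnePoint ℝ, IsCusp c Γ → ∃ i, ∃ γ ∈ Γ, γ • 𝔞 i = c)

include hΓ hneg hd hF hvol hinfty hper hineq hcomplete in
/-- **`T_k Λ` is compact for every continuous test kernel `k`**: the norm limit of the compact
operators `T_{k_η} Λ` of the Lipschitz moving averages `k_η → k`
(`‖T_k - T_{k_η}‖ ≤ C_{k - k_η}/2 → 0` by the Schur bound). [cite: Iwaniec2002, Props. 4.3–4.5 & §6.4 (6.29), PDF pp. 49–51, 88] -/
theorem isCompactOperator_kernelCLM_comp_truncOp_of_continuous {Y : ℝ} (hY : 1 ≤ Y) (hk : IsTestKernel k)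
    (hkc : Continuous k) :
    IsCompactOperator ((kernelCLM hΓ hneg hd hF hk hkc).comp (truncOp hΓ hneg hd hF hper hY)) := by
  obtain ⟨_, ⟨B, hB⟩, ⟨M, hM0, hM⟩⟩ := id hk
  -- the approximating Lipschitz kernels
  have happ : ∀ n : ℕ, ∃ η : ℝ, 0 < η ∧ η ≤ 1 ∧ ∀ u, 0 ≤ u → |avgKernel k η u - k u| ≤ 1 / ((n : ℝ) + 1) :=
    fun n => exists_avgKernel_near hkc hM (by positivity)
  choose η hη using happ
  have hkn : ∀ n, IsTestKernel (avgKernel k (η n)) := fun n => isTestKernel_avgKernel hkc hB hM hM0 (hη n).1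
  have hLn : ∀ n, LipschitzWith (Real.toNNReal (2 * B / η n)) (avgKernel k (η n)) := fun n =>
    lipschitzWith_avgKernel hkc hB (hη n).1
  have hMn : ∀ n, ∀ u, M ≤ u → avgKernel k (η n) u = 0 := fun n u hu => avgKernel_eq_zero hM (hη n).1 hu
  set Λ := truncOp hΓ hneg hd hF hper hY with hΛ
  set T := kernelCLM hΓ hneg hd hF hk hkc with hT
  set Tn : ℕ → Lp ℂ 2 ((volume : Measure ℍ).restrict F) →L[ℂ] Lp ℂ 2 ((volume : Measure ℍ).restrict F) :=
    fun n => kernelCLM hΓ hneg hd hF (hkn n) (hLn n).continuous with hTn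
  -- each `T_{k_η} Λ` is compact
  have hc : ∀ n, IsCompactOperator ((Tn n).comp Λ) := fun n =>
    isCompactOperator_kernelCLM_comp_truncOp hΓ hneg hd hF hvol hinfty hper hineq hcomplete hY (hkn n) (hLn n) (hMn n) hM0
  -- `‖T_{k_η} - T_k‖ → 0`
  have hnorm : ∀ n, ‖(Tn n).comp Λ - T.comp Λ‖ ≤ 4 * π * (1 / ((n : ℝ) + 1) * M) * ‖Λ‖ := by
    intro n
    have hdiff : Tn n - T = kernelCLM hΓ hneg hd hF ((hkn n).sub hk) ((hLn n).continuous.sub hkc) :=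
      (kernelCLM_sub_kernel hΓ hneg hd hF (hkn n) (hLn n).continuous hk hkc).symm
    have h1 : (Tn n).comp Λ - T.comp Λ = (Tn n - T).comp Λ := by rw [ContinuousLinearMap.sub_comp]
    rw [h1]
    refine (ContinuousLinearMap.opNorm_comp_le _ _).trans ?_
    gcongr
    rw [hdiff]
    refine (norm_kernelCLM_le hΓ hneg hd hF _ _).trans ?_
    have hs := schurConst_le_of_abs_le (k := fun u => avgKernel k (η n) u - k u)
      ((hLn n).continuous.measurable.sub hkc.measurable) hM0
      (fun u hu => (hη n).2.2 u hu.le) (fun u hu => by rw [hMn n u hu, hM u hu, sub_zero])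
    calc schurConst (fun u => avgKernel k (η n) u - k u) / 2 ≤ 8 * π * (1 / ((n : ℝ) + 1) * M) / 2 := by gcongr
      _ = 4 * π * (1 / ((n : ℝ) + 1) * M) := by ring
  have hlim : Tendsto (fun n => (Tn n).comp Λ) atTop (𝓝 (T.comp Λ)) := by
    rw [tendsto_iff_norm_sub_tendsto_zero]
    have h0 : Tendsto (fun n : ℕ => 4 * π * (1 / ((n : ℝ) + 1) * M) * ‖Λ‖) atTop (𝓝 (4 * π * (0 * M) * ‖Λ‖)) :=
      ((tendsto_one_div_add_atTop_nhds_zero_nat.mul_const M).const_mul (4 * π)).mul_const ‖Λ‖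
    rw [zero_mul, mul_zero, zero_mul] at h0
    exact squeeze_zero (fun n => norm_nonneg _) hnorm h0
  exact isCompactOperator_of_tendsto hlim (Eventually.of_forall hc)

end Compact

end Fuchsian

end Literature.NumberTheory.Automorphic

end
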